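import Summits.ResolutionOfSingularities.ResolutionOfSingularities.Theorems.ValuativeLuAlphaPTorsorAbhyankarDefectless
import Summits.ResolutionOfSingularities.ResolutionOfSingularities.Theorems.ValuativeLuAlphaPTorsorBestApproximation
import Literature.AlgebraicGeometry.Resolution.ValuationDefectExample
import Mathlib.FieldTheory.IntermediateField.Adjoin.Algebra
import Mathlib.Algebra.CharP.Lemmas
import HarnessLib

/-!
# The purely inseparable tower above `k(K^{p^e})`: basic facts

Crux `Valuative.LuAlphaPTorsor` (item `stmt-ResolutionOfSingularities-0641`), line
`pfaff-line-log-final-forms`, reshape v6 (lead seat c4), assembly S6.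

For a finitely generated extension `K = k(s)` of characteristic `p` and `e : ℕ`, the subfield
`K_e = k(K^{p^e}) = k(z^{p^e} : z ∈ s)` is finitely generated, `K` is finite and purely inseparable
over every intermediate field `M ⊇ K_e`, a valuation ring `O` of `K` is the only one above
`O ∩ M`, and if `O ⊇ k` is an Abhyankar place of `K/k` then `(M, O ∩ M)` is defectless in `K`
(Kuhlmann's generalized stability theorem, PROVED in the tree), so that every `t ∈ K` has a best
approximation in `M` (`exists_forall_valuation_sub_le_of_isDefectlessIn`).
-/

set_option linter.dupNamespace false

open IsLocalRing

namespace Summit.ResolutionOfSingularities.ResolutionOfSingularities.Theorems.PfaffLine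

open Literature.AlgebraicGeometry.Resolution

variable {k K : Type} [Field k] [Field K] [Algebra k K]

/-! ### `K_e = k(K^{p^e})` -/

/-- `k(K^{q})` is generated over `k` by the `q`-th powers of any set of generators of `K/k`
(`q` a power of the characteristic: Frobenius is additive). [folklore] -/
theorem adjoin_range_pow_eq_adjoin_image {p : ℕ} [Fact p.Prime] [CharP K p] (e : ℕ)
    (s : Set K) (hs : IntermediateField.adjoin k s = ⊤) :
    IntermediateField.adjoin k (Set.range fun z : K => z ^ p ^ e) =
      IntermediateField.adjoin k ((fun z : K => z ^ p ^ e) '' s) := by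
  apply le_antisymm
  · rw [IntermediateField.adjoin_le_iff]
    rintro _ ⟨z, rfl⟩
    -- the preimage of `k(s^{q})` under the `q`-th power Frobenius is a subfield containing `k ∪ s`
    let φ : K →+* K := iterateFrobenius K p e
    have hφ : ∀ y : K, φ y = y ^ p ^ e := fun y => iterateFrobenius_def ..
    let T : Subfield K := (IntermediateField.adjoin k ((fun z : K => z ^ p ^ e) '' s)).toSubfield.comap φ
    have hT : (IntermediateField.adjoin k s).toSubfield ≤ T := by
      rw [IntermediateField.adjoin_toSubfield, Subfield.closure_le]
      rintro y (⟨c, rfl⟩ | hy)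
      · show (algebraMap k K c) ∈ T
        rw [Subfield.mem_comap, hφ, ← map_pow]
        exact IntermediateField.algebraMap_mem _ _
      · show y ∈ T
        rw [Subfield.mem_comap, hφ]
        exact IntermediateField.subset_adjoin k _ ⟨y, hy, rfl⟩
    have hz : z ∈ (IntermediateField.adjoin k s).toSubfield := by
      rw [hs]; trivial
    have hzT := hT hz
    rw [Subfield.mem_comap, hφ] at hzT
    exact hzT
  · exact IntermediateField.adjoin.mono k _ _ (by rintro _ ⟨z, -, rfl⟩; exact ⟨z, rfl⟩)

/-- Every `z ∈ K` has `z ^ p ^ e ∈ k(K^{p^e})`. [folklore] -/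
theorem pow_mem_adjoin_range_pow (p e : ℕ) (z : K) :
    z ^ p ^ e ∈ IntermediateField.adjoin k (Set.range fun z : K => z ^ p ^ e) :=
  IntermediateField.subset_adjoin k _ ⟨z, rfl⟩

/-- An intermediate field generated by a finite set is finitely generated over `k` as a field in
its own right (`(⊤ : IntermediateField k M).FG`). [folklore] -/
theorem fg_top_of_eq_adjoin_finset (M : IntermediateField k K) (s : Finset K)
    (hM : M = IntermediateField.adjoin k (s : Set K)) :
    (⊤ : IntermediateField k M).FG := by
  classical
  have hsM : ∀ z ∈ s, z ∈ M := fun z hz => by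
    rw [hM]; exact IntermediateField.subset_adjoin k _ hz
  let s₀ : Set M := Subtype.val ⁻¹' (s : Set K)
  have hs₀ : s₀.Finite := s.finite_toSet.preimage Subtype.val_injective.injOn
  refine IntermediateField.fg_def.mpr ⟨s₀, hs₀, ?_⟩
  apply IntermediateField.lift_injective M
  rw [IntermediateField.lift_adjoin, IntermediateField.lift_top]
  have himage : Subtype.val '' s₀ = (s : Set K) := by
    rw [Set.image_preimage_eq_iff]
    intro z hz
    exact ⟨⟨z, hsM z hz⟩, rfl⟩
  rw [himage, ← hM]

/-- If every element of the finitely generated `K = k(s)` has its `n`-th power (`n ≠ 0`) in the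
intermediate field `M`, then `K` is finite over `M`. [folklore] -/
theorem finiteDimensional_of_forall_pow_mem (M : IntermediateField k K) (s : Finset K)
    (hs : IntermediateField.adjoin k (s : Set K) = ⊤) {n : ℕ} (hn : n ≠ 0)
    (hM : ∀ z : K, z ^ n ∈ M) : FiniteDimensional M K := by
  classical
  have hint : ∀ z ∈ s, IsIntegral M z := fun z _ =>
    IsIntegral.of_pow (Nat.pos_of_ne_zero hn)
      (isIntegral_algebraMap (x := (⟨z ^ n, hM z⟩ : M)))
  haveI : FiniteDimensional M (IntermediateField.adjoin M (s : Set K)) :=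
    IntermediateField.finiteDimensional_adjoin hint
  have htop : IntermediateField.adjoin M (s : Set K) = ⊤ := by
    apply IntermediateField.restrictScalars_injective k
    rw [IntermediateField.restrictScalars_top, eq_top_iff, ← hs, IntermediateField.adjoin_le_iff]
    exact fun z hz => IntermediateField.subset_adjoin M _ hz
  rw [htop] at this
  exact LinearEquiv.finiteDimensional
    (IntermediateField.topEquiv (F := M) (E := K)).toLinearEquiv

/-- Above an intermediate field `M` containing all `n`-th powers (`n ≠ 0`), a valuation ring of
`K` is determined by its trace on `M`: `O` is the only valuation ring of `K` over `O ∩ M`.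
[folklore] -/
theorem valuationSubring_eq_of_comap_eq_of_forall_pow_mem (O : ValuationSubring K)
    (M : IntermediateField k K) {n : ℕ} (hn : n ≠ 0) (hM : ∀ z : K, z ^ n ∈ M)
    (O'' : ValuationSubring K)
    (h : O''.comap (algebraMap M K) = O.comap (algebraMap M K)) : O'' = O := by
  ext z
  rw [mem_valuationSubring_iff_pow_mem O'' z hn, mem_valuationSubring_iff_pow_mem O z hn]
  have h1 : z ^ n ∈ O'' ↔ (⟨z ^ n, hM z⟩ : M) ∈ O''.comap (algebraMap M K) := Iff.rfl
  have h2 : z ^ n ∈ O ↔ (⟨z ^ n, hM z⟩ : M) ∈ O.comap (algebraMap M K) := Iff.rfl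
  rw [h1, h2, h]

/-- **Defectlessness along the tower.** If `O ⊇ k` is an Abhyankar place of the finitely
generated `K = k(s)` of characteristic `p`, and the finitely generated intermediate field
`M = k(s')` contains all `p^e`-th powers (`e ≥ 1` or at any rate `p ^ e ≠ 0`), then `(M, O ∩ M)`
is defectless in `K` — `M/k` is a function field without transcendence defect
(`transcendenceDefect_comap_eq_zero_of_pow_mem`), hence a defectless field by Kuhlmann's
generalized stability theorem (`Kuhlmann2010Stability_holds`). [cite: Kuhlmann2010, Thm. 1.1] -/
theorem isDefectlessIn_of_forall_pow_mem (O : ValuationSubring K)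
    (hk : ∀ c : k, algebraMap k K c ∈ O)
    (hA : IsAbhyankarPlace O (algebraMap k K).fieldRange ⊤)
    (s : Finset K) (hs : IntermediateField.adjoin k (s : Set K) = ⊤)
    (M : IntermediateField k K) (s' : Finset K) (hM' : M = IntermediateField.adjoin k (s' : Set K))
    {q : ℕ} (hq : 0 < q) (hM : ∀ z : K, z ^ q ∈ M) :
    IsDefectlessIn M (O.comap (algebraMap M K)) K := by
  have hk₀ : ∀ c : k, algebraMap k M c ∈ O.comap (algebraMap M K) := fun c => by
    rw [ValuationSubring.mem_comap, ← IsScalarTower.algebraMap_apply]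
    exact hk c
  have hD : transcendenceDefect k (O.comap (algebraMap M K)) hk₀ = 0 :=
    transcendenceDefect_comap_eq_zero_of_pow_mem O hk hq M hM hk₀ hA
  have hdf : IsDefectlessField M (O.comap (algebraMap M K)) :=
    Kuhlmann2010Stability_holds k M (fg_top_of_eq_adjoin_finset M s' hM') _ hk₀ hD
  haveI := finiteDimensional_of_forall_pow_mem M s hs hq.ne' hM
  exact hdf K inferInstance

/-- **Best approximations along the tower** (Abhyankar place, `M ⊇ K^{q}` finitely generated):
every `t ∈ K` has a best approximation `c₀ ∈ M`, i.e. `v(t − c₀) ≤ v(t − c)` for all `c ∈ M`.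
[folklore] -/
theorem exists_bestApprox_of_forall_pow_mem (O : ValuationSubring K)
    (hk : ∀ c : k, algebraMap k K c ∈ O)
    (hA : IsAbhyankarPlace O (algebraMap k K).fieldRange ⊤)
    (s : Finset K) (hs : IntermediateField.adjoin k (s : Set K) = ⊤)
    (M : IntermediateField k K) (s' : Finset K) (hM' : M = IntermediateField.adjoin k (s' : Set K))
    {q : ℕ} (hq : 0 < q) (hM : ∀ z : K, z ^ q ∈ M) (t : K) :
    ∃ c₀ : K, c₀ ∈ M ∧ ∀ c : K, c ∈ M → O.valuation (t - c₀) ≤ O.valuation (t - c) := by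
  haveI := finiteDimensional_of_forall_pow_mem M s hs hq.ne' hM
  obtain ⟨c₀, hc₀⟩ := exists_forall_valuation_sub_le_of_isDefectlessIn O
    (valuationSubring_eq_of_comap_eq_of_forall_pow_mem O M hq.ne' hM)
    (isDefectlessIn_of_forall_pow_mem O hk hA s hs M s' hM' hq hM) t
  exact ⟨c₀, c₀.2, fun c hc => hc₀ ⟨c, hc⟩⟩

/-- **Best approximations along the tower** (registered sub-goal form of
`exists_bestApprox_of_forall_pow_mem`, binders explicit). [folklore] -/
theorem bestApprox_of_forall_pow_mem :
    ∀ (k K : Type) [Field k] [Field K] [Algebra k K] (O : ValuationSubring K), (∀ c : k, algebraMap k K c ∈ O) → Literature.AlgebraicGeometry.Resolution.IsAbhyankarPlace O (algebraMap k K).fieldRange ⊤ → ∀ (s : Finset K), IntermediateField.adjoin k (s : Set K) = ⊤ → ∀ (M : IntermediateField k K) (s' : Finset K), M = IntermediateField.adjoin k (s' : Set K) → ∀ (q : ℕ), 0 < q → (∀ z : K, z ^ q ∈ M) → ∀ (t : K), ∃ c₀ : K, c₀ ∈ M ∧ ∀ c : K, c ∈ M → O.valuation (t - c₀) ≤ O.valuation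 (t - c) := by
  intro k K _ _ _ O hk hA s hs M s' hM' q hq hM t
  exact exists_bestApprox_of_forall_pow_mem O hk hA s hs M s' hM' hq hM t

end Summit.ResolutionOfSingularities.ResolutionOfSingularities.Theorems.PfaffLine
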